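import Literature.MathematicalPhysics.QuantumLattice.GrassmannIntegralWilsonProofs
import Literature.MathematicalPhysics.QuantumLattice.WilsonHoppingAlgebra

/-!
# Toolkit for stub `stub_feshbachLocalisation` of line `proper-time-quarantine`
(crux `Summit.QuantumFields.QCD.Theses.NestedDissectionSea.SeaFactorisationBridge`,
item stmt-QuantumFields-13880)

Finite-dimensional bookkeeping for the Feshbach–Combes–Thomas localisation of sub-threshold
eigenvectors of `Γ₅ D_W` (sibling file `…StubFeshbachLocalisation.lean`), all PROVED, no new
definitions: Euclidean-norm (`eucNorm`) estimates for sums, diagonal multiplication operators and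
pointwise comparisons; the partial-isometry norm bound `‖A‖ ≤ 1` from `(AᴴA)² = AᴴA`; the scalar
Combes–Thomas inequality `|e^{νδ} − 1| ≤ e^ν − 1` (`|δ| ≤ 1`); the site cut-off
`P_Ω v = Set.indicator {p | Ω (site p)} v` and the `Γ₅`-isometry on lattice fermions; the forward /
backward halves `F_μ ⊗ P⁻_μ`, `F_μᴴ ⊗ P⁺_μ` of the Wilson hopping matrices `W_μ`
(`OverlapLocality.wilsonHop`, `F_μ = linkHop`) with their kernels and contractivity, the bound
`‖(Σ_μ W_μ) v‖₂ ≤ 4‖v‖₂` and nearest-neighbour locality; and the commutator identities of the two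
halves with a site-diagonal multiplication operator `diag(d(site))`.
-/

noncomputable section

namespace Summit.QuantumFields.QCD.Cruxes.SeaFactorisationBridge.ProperTimeQuarantine

open scoped BigOperators Kronecker ComplexConjugate Matrix.Norms.L2Operator
open Matrix Finset
open Literature.MathematicalPhysics.QuantumFieldTheory Literature.MathematicalPhysics.QuantumLattice
open Literature.MathematicalPhysics.QuantumLattice.NeubergerBound
open Literature.Probability.LatticeModels (TorusSite)

/-! ### Euclidean-norm bookkeeping on a finite index type -/

section General

variable {ι : Type*} [Fintype ι] [DecidableEq ι]

omit [DecidableEq ι] in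
/-- `‖Σ_i f_i‖₂ ≤ Σ_i ‖f_i‖₂`. [folklore] -/
theorem eucNorm_sum_le {α : Type*} (s : Finset α) (f : α → ι → ℂ) :
    eucNorm (∑ i ∈ s, f i) ≤ ∑ i ∈ s, eucNorm (f i) :=
  Finset.le_sum_of_subadditive eucNorm eucNorm_zero.le eucNorm_add_le s f

omit [DecidableEq ι] in
/-- A pointwise bound `‖v p‖ ≤ c‖w p‖` (`c ≥ 0`) gives `‖v‖₂ ≤ c‖w‖₂`. [folklore] -/
theorem eucNorm_le_mul_of_pointwise {v w : ι → ℂ} {c : ℝ} (hc : 0 ≤ c)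
    (h : ∀ p, ‖v p‖ ≤ c * ‖w p‖) : eucNorm v ≤ c * eucNorm w := by
  rw [← pow_le_pow_iff_left₀ (eucNorm_nonneg v) (mul_nonneg hc (eucNorm_nonneg w)) two_ne_zero,
    mul_pow, eucNorm_sq_eq_sum, eucNorm_sq_eq_sum, Finset.mul_sum]
  refine Finset.sum_le_sum fun p _ => ?_
  rw [← mul_pow]
  exact pow_le_pow_left₀ (norm_nonneg _) (h p) 2

omit [DecidableEq ι] in
/-- A pointwise bound `‖v p‖ ≤ ‖w p‖` gives `‖v‖₂ ≤ ‖w‖₂`. [folklore] -/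
theorem eucNorm_le_of_pointwise {v w : ι → ℂ} (h : ∀ p, ‖v p‖ ≤ ‖w p‖) :
    eucNorm v ≤ eucNorm w := by
  have := eucNorm_le_mul_of_pointwise (v := v) (w := w) zero_le_one (fun p => by
    rw [one_mul]; exact h p)
  rwa [one_mul] at this

/-- Diagonal multiplication with entries of modulus `≤ M` is `M`-bounded in `‖·‖₂`. [folklore] -/
theorem eucNorm_diagonal_mulVec_le {d : ι → ℂ} {M : ℝ} (hM : 0 ≤ M) (hd : ∀ p, ‖d p‖ ≤ M)
    (v : ι → ℂ) : eucNorm (diagonal d *ᵥ v) ≤ M * eucNorm v := by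
  refine eucNorm_le_mul_of_pointwise hM fun p => ?_
  rw [mulVec_diagonal, norm_mul]
  exact mul_le_mul_of_nonneg_right (hd p) (norm_nonneg _)

/-- Diagonal multiplication operators commute (on vectors). [folklore] -/
theorem diagonal_mulVec_diagonal_mulVec_comm (d₁ d₂ : ι → ℂ) (v : ι → ℂ) :
    diagonal d₁ *ᵥ (diagonal d₂ *ᵥ v) = diagonal d₂ *ᵥ (diagonal d₁ *ᵥ v) := by
  funext p
  simp only [mulVec_diagonal]
  ring

/-- A matrix whose Gram matrix `AᴴA` is idempotent (a partial isometry) has `ℓ²` operator norm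
at most one. [folklore] -/
theorem l2_opNorm_le_one_of_gram_idem {A : Matrix ι ι ℂ} (h : Aᴴ * A * (Aᴴ * A) = Aᴴ * A) :
    ‖A‖ ≤ 1 := by
  set P := Aᴴ * A with hP
  have hPh : Pᴴ = P := by rw [hP, conjTranspose_mul, conjTranspose_conjTranspose]
  have h1 : ‖P‖ * ‖P‖ = ‖P‖ := by
    rw [← Matrix.l2_opNorm_conjTranspose_mul_self, hPh, h]
  have h2 : ‖P‖ ≤ 1 := by nlinarith [norm_nonneg P]
  have h3 : ‖A‖ * ‖A‖ ≤ 1 := by rw [← Matrix.l2_opNorm_conjTranspose_mul_self]; exact h2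
  nlinarith [norm_nonneg A]

/-- `|e^{νδ} − 1| ≤ e^ν − 1` for `ν ≥ 0`, `|δ| ≤ 1`. [folklore] -/
theorem abs_exp_mul_sub_one_le {ν δ : ℝ} (hν : 0 ≤ ν) (hδ : |δ| ≤ 1) :
    |Real.exp (ν * δ) - 1| ≤ Real.exp ν - 1 := by
  obtain ⟨hδ₁, hδ₂⟩ := abs_le.mp hδ
  rw [abs_le]
  constructor
  · have h1 : Real.exp (-ν) ≤ Real.exp (ν * δ) := Real.exp_le_exp.mpr (by nlinarith)
    have h2 := Real.add_one_le_exp ν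
    have h3 := Real.add_one_le_exp (-ν)
    linarith
  · have h1 : Real.exp (ν * δ) ≤ Real.exp ν := Real.exp_le_exp.mpr (by nlinarith)
    linarith

end General

/-! ### The site cut-off `P_Ω` and the `Γ₅` sign matrix on lattice fermions -/

section Lattice

variable {L Nc : ℕ} (Ω : TorusSite 4 L → Prop)

/-- `P_Ω v` vanishes at sites outside `Ω`. [folklore] -/
theorem siteCut_apply_of_not {v : TorusSite 4 L × Fin Nc × Fin 4 → ℂ}
    {p : TorusSite 4 L × Fin Nc × Fin 4} (hp : ¬ Ω p.1) :
    Set.indicator {q : TorusSite 4 L × Fin Nc × Fin 4 | Ω q.1} v p = 0 :=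
  Set.indicator_of_notMem (show p ∉ {q : TorusSite 4 L × Fin Nc × Fin 4 | Ω q.1} from hp) v

/-- `P_Ω v = v` at sites of `Ω`. [folklore] -/
theorem siteCut_apply_of_mem {v : TorusSite 4 L × Fin Nc × Fin 4 → ℂ}
    {p : TorusSite 4 L × Fin Nc × Fin 4} (hp : Ω p.1) :
    Set.indicator {q : TorusSite 4 L × Fin Nc × Fin 4 | Ω q.1} v p = v p :=
  Set.indicator_of_mem (show p ∈ {q : TorusSite 4 L × Fin Nc × Fin 4 | Ω q.1} from hp) v

/-- `P_Ω` is idempotent. [folklore] -/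
theorem siteCut_siteCut (v : TorusSite 4 L × Fin Nc × Fin 4 → ℂ) :
    Set.indicator {q : TorusSite 4 L × Fin Nc × Fin 4 | Ω q.1} (Set.indicator {q | Ω q.1} v) =
      Set.indicator {q | Ω q.1} v := by
  funext p
  by_cases hp : Ω p.1
  · rw [siteCut_apply_of_mem Ω hp, siteCut_apply_of_mem Ω hp]
  · rw [siteCut_apply_of_not Ω hp, siteCut_apply_of_not Ω hp]

/-- `P_Ω` is additive. [folklore] -/
theorem siteCut_sub (v w : TorusSite 4 L × Fin Nc × Fin 4 → ℂ) :
    Set.indicator {q : TorusSite 4 L × Fin Nc × Fin 4 | Ω q.1} (v - w) =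
      Set.indicator {q | Ω q.1} v - Set.indicator {q | Ω q.1} w := by
  funext p
  by_cases hp : Ω p.1
  · simp only [Pi.sub_apply, siteCut_apply_of_mem Ω hp]
  · simp only [Pi.sub_apply, siteCut_apply_of_not Ω hp, sub_zero]

/-- `P_Ω` is homogeneous. [folklore] -/
theorem siteCut_smul (c : ℂ) (v : TorusSite 4 L × Fin Nc × Fin 4 → ℂ) :
    Set.indicator {q : TorusSite 4 L × Fin Nc × Fin 4 | Ω q.1} (c • v) =
      c • Set.indicator {q | Ω q.1} v := by
  funext p
  by_cases hp : Ω p.1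
  · simp only [Pi.smul_apply, siteCut_apply_of_mem Ω hp]
  · simp only [Pi.smul_apply, siteCut_apply_of_not Ω hp, smul_zero]

variable [NeZero L]

/-- `P_Ω` commutes with every diagonal (multiplication) operator. [folklore] -/
theorem siteCut_diagonal_mulVec (d : TorusSite 4 L × Fin Nc × Fin 4 → ℂ)
    (v : TorusSite 4 L × Fin Nc × Fin 4 → ℂ) :
    Set.indicator {q : TorusSite 4 L × Fin Nc × Fin 4 | Ω q.1} (diagonal d *ᵥ v) =
      diagonal d *ᵥ Set.indicator {q | Ω q.1} v := by
  funext p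
  by_cases hp : Ω p.1
  · simp only [mulVec_diagonal, siteCut_apply_of_mem Ω hp]
  · simp only [mulVec_diagonal, siteCut_apply_of_not Ω hp, mul_zero]

/-- `‖P_Ω v‖₂² = Σ_{sites of Ω} ‖v p‖²`. [folklore] -/
theorem eucNorm_siteCut_sq [DecidablePred Ω] (v : TorusSite 4 L × Fin Nc × Fin 4 → ℂ) :
    eucNorm (Set.indicator {q : TorusSite 4 L × Fin Nc × Fin 4 | Ω q.1} v) ^ 2 =
      ∑ p ∈ Finset.univ.filter (fun p : TorusSite 4 L × Fin Nc × Fin 4 => Ω p.1), ‖v p‖ ^ 2 := by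
  rw [eucNorm_sq_eq_sum, Finset.sum_filter]
  refine Finset.sum_congr rfl fun p _ => ?_
  by_cases hp : Ω p.1
  · rw [siteCut_apply_of_mem Ω hp, if_pos hp]
  · rw [siteCut_apply_of_not Ω hp, if_neg hp, norm_zero, zero_pow two_ne_zero]

/-- `‖P_Ω v‖₂ ≤ ‖v‖₂`. [folklore] -/
theorem eucNorm_siteCut_le (v : TorusSite 4 L × Fin Nc × Fin 4 → ℂ) :
    eucNorm (Set.indicator {q : TorusSite 4 L × Fin Nc × Fin 4 | Ω q.1} v) ≤ eucNorm v :=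
  eucNorm_le_of_pointwise fun p => by
    by_cases hp : Ω p.1
    · rw [siteCut_apply_of_mem Ω hp]
    · rw [siteCut_apply_of_not Ω hp, norm_zero]; exact norm_nonneg _

/-- `‖v − P_Ω v‖₂ ≤ ‖v‖₂`. [folklore] -/
theorem eucNorm_sub_siteCut_le (v : TorusSite 4 L × Fin Nc × Fin 4 → ℂ) :
    eucNorm (v - Set.indicator {q : TorusSite 4 L × Fin Nc × Fin 4 | Ω q.1} v) ≤ eucNorm v :=
  eucNorm_le_of_pointwise fun p => by
    by_cases hp : Ω p.1
    · rw [Pi.sub_apply, siteCut_apply_of_mem Ω hp, sub_self, norm_zero]; exact norm_nonneg _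
    · rw [Pi.sub_apply, siteCut_apply_of_not Ω hp, sub_zero]

/-- `Γ₅ = 1 ⊗ 1 ⊗ γ₅` preserves every component modulus (`γ₅ = diag(1,1,−1,−1)`). [folklore] -/
theorem norm_spinorLift_gammaFive_mulVec_apply (v : TorusSite 4 L × Fin Nc × Fin 4 → ℂ)
    (p : TorusSite 4 L × Fin Nc × Fin 4) :
    ‖(spinorLift gammaFive *ᵥ v) p‖ = ‖v p‖ := by
  rw [spinorLift_gammaFive_eq_diagonal, mulVec_diagonal, norm_mul]
  have : ‖(![1, 1, -1, -1] : Fin 4 → ℂ) p.2.2‖ = 1 := by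
    obtain ⟨x, a, α⟩ := p
    fin_cases α <;> simp
  rw [this, one_mul]

/-- `‖Γ₅ v‖₂ = ‖v‖₂`. [folklore] -/
theorem eucNorm_spinorLift_gammaFive_mulVec (v : TorusSite 4 L × Fin Nc × Fin 4 → ℂ) :
    eucNorm (spinorLift gammaFive *ᵥ v) = eucNorm v := by
  rw [← pow_left_inj₀ (eucNorm_nonneg _) (eucNorm_nonneg v) two_ne_zero, eucNorm_sq_eq_sum,
    eucNorm_sq_eq_sum]
  simp_rw [norm_spinorLift_gammaFive_mulVec_apply]

/-- `Γ₅` commutes with the site cut-off. [folklore] -/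
theorem siteCut_spinorLift_gammaFive_mulVec (v : TorusSite 4 L × Fin Nc × Fin 4 → ℂ) :
    Set.indicator {q : TorusSite 4 L × Fin Nc × Fin 4 | Ω q.1} (spinorLift gammaFive *ᵥ v) =
      spinorLift gammaFive *ᵥ Set.indicator {q | Ω q.1} v := by
  rw [spinorLift_gammaFive_eq_diagonal, siteCut_diagonal_mulVec]

/-- `Γ₅` commutes with every diagonal (multiplication) operator. [folklore] -/
theorem spinorLift_gammaFive_mulVec_diagonal_mulVec (d : TorusSite 4 L × Fin Nc × Fin 4 → ℂ)
    (v : TorusSite 4 L × Fin Nc × Fin 4 → ℂ) :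
    spinorLift gammaFive *ᵥ (diagonal d *ᵥ v) = diagonal d *ᵥ (spinorLift gammaFive *ᵥ v) := by
  rw [spinorLift_gammaFive_eq_diagonal, diagonal_mulVec_diagonal_mulVec_comm]

/-! ### The two halves of the Wilson hopping matrix -/

variable {G : Type*} [Group G] (ρ : G →* Matrix (Fin Nc) (Fin Nc) ℂ)

omit [NeZero L] in
/-- `W_μ = (F_μ ⊗ P⁻_μ) + (F_μᴴ ⊗ P⁺_μ)` (forward and backward halves). [folklore] -/
theorem wilsonHop_eq_fwd_add_bwd (U : GaugeConfig 4 L G) (i : Fin 4) :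
    wilsonHop ρ U i =
      Matrix.reindex (Equiv.prodAssoc _ _ _) (Equiv.prodAssoc _ _ _)
          (linkHop ρ U i ⊗ₖ chiralProjMinus i) +
        Matrix.reindex (Equiv.prodAssoc _ _ _) (Equiv.prodAssoc _ _ _)
          ((linkHop ρ U i)ᴴ ⊗ₖ chiralProjPlus i) := rfl

omit [NeZero L] in
/-- Kernel of the forward half: `δ_{y,x+î} ρ(U(x,i))_{ab} (P⁻_i)_{αβ}`. [folklore] -/
theorem hopFwd_apply (U : GaugeConfig 4 L G) (i : Fin 4) (p q : TorusSite 4 L × Fin Nc × Fin 4) :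
    Matrix.reindex (Equiv.prodAssoc _ _ _) (Equiv.prodAssoc _ _ _)
        (linkHop ρ U i ⊗ₖ chiralProjMinus i) p q =
      if q.1 = Site.shift p.1 i then ρ (U (p.1, i)) p.2.1 q.2.1 * chiralProjMinus i p.2.2 q.2.2
      else 0 := by
  simp only [Matrix.reindex_apply, submatrix_apply, Equiv.prodAssoc_symm_apply,
    kroneckerMap_apply, linkHop, of_apply, ite_mul, zero_mul]

omit [NeZero L] in
/-- Kernel of the backward half: `δ_{x,y+î} conj(ρ(U(y,i))_{ba}) (P⁺_i)_{αβ}`. [folklore] -/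
theorem hopBwd_apply (U : GaugeConfig 4 L G) (i : Fin 4) (p q : TorusSite 4 L × Fin Nc × Fin 4) :
    Matrix.reindex (Equiv.prodAssoc _ _ _) (Equiv.prodAssoc _ _ _)
        ((linkHop ρ U i)ᴴ ⊗ₖ chiralProjPlus i) p q =
      if p.1 = Site.shift q.1 i then star (ρ (U (q.1, i)) q.2.1 p.2.1) * chiralProjPlus i p.2.2 q.2.2
      else 0 := by
  simp only [Matrix.reindex_apply, submatrix_apply, Equiv.prodAssoc_symm_apply,
    kroneckerMap_apply, conjTranspose_apply, linkHop, of_apply, star_ite_zero, ite_mul, zero_mul]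

/-- `1 ⊗ 1 ⊗ P` is idempotent for an idempotent spin matrix `P`. [folklore] -/
theorem spinProjLift_mul_self (P : Matrix (Fin 4) (Fin 4) ℂ) (hP : P * P = P) :
    Matrix.reindex (Equiv.prodAssoc _ _ _) (Equiv.prodAssoc _ _ _)
        ((1 : Matrix (TorusSite 4 L × Fin Nc) (TorusSite 4 L × Fin Nc) ℂ) ⊗ₖ P) *
      Matrix.reindex (Equiv.prodAssoc _ _ _) (Equiv.prodAssoc _ _ _)
        ((1 : Matrix (TorusSite 4 L × Fin Nc) (TorusSite 4 L × Fin Nc) ℂ) ⊗ₖ P) =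
      Matrix.reindex (Equiv.prodAssoc _ _ _) (Equiv.prodAssoc (TorusSite 4 L) (Fin Nc) (Fin 4))
        ((1 : Matrix (TorusSite 4 L × Fin Nc) (TorusSite 4 L × Fin Nc) ℂ) ⊗ₖ P) := by
  rw [Matrix.reindex_apply, submatrix_mul_equiv, ← mul_kronecker_mul, Matrix.mul_one, hP]

/-- The forward half is a contraction, `‖(F ⊗ P⁻) v‖₂ ≤ ‖v‖₂`: its Gram matrix is the
projection `1 ⊗ P⁻`. [folklore] -/
theorem eucNorm_hopFwd_mulVec_le (hρ : ∀ g, ρ g ∈ Matrix.unitaryGroup (Fin Nc) ℂ)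
    (U : GaugeConfig 4 L G) (i : Fin 4) (v : TorusSite 4 L × Fin Nc × Fin 4 → ℂ) :
    eucNorm (Matrix.reindex (Equiv.prodAssoc _ _ _) (Equiv.prodAssoc _ _ _)
        (linkHop ρ U i ⊗ₖ chiralProjMinus i) *ᵥ v) ≤ eucNorm v := by
  have hgram : (Matrix.reindex (Equiv.prodAssoc _ _ _) (Equiv.prodAssoc _ _ _)
      (linkHop ρ U i ⊗ₖ chiralProjMinus i))ᴴ *
        Matrix.reindex (Equiv.prodAssoc _ _ _) (Equiv.prodAssoc _ _ _)
          (linkHop ρ U i ⊗ₖ chiralProjMinus i) =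
      Matrix.reindex (Equiv.prodAssoc _ _ _) (Equiv.prodAssoc (TorusSite 4 L) (Fin Nc) (Fin 4))
        ((1 : Matrix (TorusSite 4 L × Fin Nc) (TorusSite 4 L × Fin Nc) ℂ) ⊗ₖ chiralProjMinus i) := by
    rw [Matrix.reindex_apply, Matrix.reindex_apply, conjTranspose_submatrix,
      submatrix_mul_equiv, conjTranspose_kronecker, ← mul_kronecker_mul,
      conjTranspose_mul_linkHop ρ hρ U i, chiralProjMinus_conjTranspose, chiralProjMinus_mul_self]
  have h1 := l2_opNorm_le_one_of_gram_idem (by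
    rw [hgram]; exact spinProjLift_mul_self _ (chiralProjMinus_mul_self i))
  exact (eucNorm_mulVec_le _ v).trans (mul_le_of_le_one_left (eucNorm_nonneg v) h1)

/-- The backward half is a contraction, `‖(Fᴴ ⊗ P⁺) v‖₂ ≤ ‖v‖₂`: its Gram matrix is the
projection `1 ⊗ P⁺`. [folklore] -/
theorem eucNorm_hopBwd_mulVec_le (hρ : ∀ g, ρ g ∈ Matrix.unitaryGroup (Fin Nc) ℂ)
    (U : GaugeConfig 4 L G) (i : Fin 4) (v : TorusSite 4 L × Fin Nc × Fin 4 → ℂ) :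
    eucNorm (Matrix.reindex (Equiv.prodAssoc _ _ _) (Equiv.prodAssoc _ _ _)
        ((linkHop ρ U i)ᴴ ⊗ₖ chiralProjPlus i) *ᵥ v) ≤ eucNorm v := by
  have hgram : (Matrix.reindex (Equiv.prodAssoc _ _ _) (Equiv.prodAssoc _ _ _)
      ((linkHop ρ U i)ᴴ ⊗ₖ chiralProjPlus i))ᴴ *
        Matrix.reindex (Equiv.prodAssoc _ _ _) (Equiv.prodAssoc _ _ _)
          ((linkHop ρ U i)ᴴ ⊗ₖ chiralProjPlus i) =
      Matrix.reindex (Equiv.prodAssoc _ _ _) (Equiv.prodAssoc (TorusSite 4 L) (Fin Nc) (Fin 4))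
        ((1 : Matrix (TorusSite 4 L × Fin Nc) (TorusSite 4 L × Fin Nc) ℂ) ⊗ₖ chiralProjPlus i) := by
    rw [Matrix.reindex_apply, Matrix.reindex_apply, conjTranspose_submatrix,
      submatrix_mul_equiv, conjTranspose_kronecker, conjTranspose_conjTranspose, ← mul_kronecker_mul,
      linkHop_mul_conjTranspose ρ hρ U i, chiralProjPlus_conjTranspose, chiralProjPlus_mul_self]
  have h1 := l2_opNorm_le_one_of_gram_idem (by
    rw [hgram]; exact spinProjLift_mul_self _ (chiralProjPlus_mul_self i))
  exact (eucNorm_mulVec_le _ v).trans (mul_le_of_le_one_left (eucNorm_nonneg v) h1)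

/-- **The hopping term is bounded by four**: `‖(Σ_μ W_μ) v‖₂ ≤ 4‖v‖₂` (each `W_μ` is an
isometry). [folklore] -/
theorem eucNorm_sum_wilsonHop_mulVec_le (hρ : ∀ g, ρ g ∈ Matrix.unitaryGroup (Fin Nc) ℂ)
    (U : GaugeConfig 4 L G) (v : TorusSite 4 L × Fin Nc × Fin 4 → ℂ) :
    eucNorm ((∑ i, wilsonHop ρ U i) *ᵥ v) ≤ 4 * eucNorm v := by
  rw [sum_mulVec]
  calc eucNorm (∑ i, wilsonHop ρ U i *ᵥ v) ≤ ∑ i, eucNorm (wilsonHop ρ U i *ᵥ v) :=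
        eucNorm_sum_le _ _
    _ = ∑ _i : Fin 4, eucNorm v := Finset.sum_congr rfl fun i _ =>
        eucNorm_mulVec_of_conjTranspose_mul_self (conjTranspose_mul_wilsonHop ρ hρ U i) v
    _ = 4 * eucNorm v := by simp

/-- **Nearest-neighbour locality of the hopping term**: `((Σ_μ W_μ) v)(p)` vanishes when `v`
vanishes at every site `x ± μ̂` adjacent to the site `x` of `p`. [folklore] -/
theorem sum_wilsonHop_mulVec_apply_eq_zero (U : GaugeConfig 4 L G)
    (v : TorusSite 4 L × Fin Nc × Fin 4 → ℂ) (p : TorusSite 4 L × Fin Nc × Fin 4)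
    (hv : ∀ (q : TorusSite 4 L × Fin Nc × Fin 4) (i : Fin 4),
      (q.1 = Site.shift p.1 i ∨ p.1 = Site.shift q.1 i) → v q = 0) :
    ((∑ i, wilsonHop ρ U i) *ᵥ v) p = 0 := by
  rw [sum_mulVec, Finset.sum_apply]
  refine Finset.sum_eq_zero fun i _ => ?_
  rw [wilsonHop_eq_fwd_add_bwd, add_mulVec, Pi.add_apply, mulVec, mulVec, dotProduct,
    dotProduct, ← Finset.sum_add_distrib]
  refine Finset.sum_eq_zero fun q _ => ?_
  rw [hopFwd_apply, hopBwd_apply]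
  by_cases h1 : q.1 = Site.shift p.1 i
  · rw [hv q i (Or.inl h1), mul_zero, mul_zero, add_zero]
  · by_cases h2 : p.1 = Site.shift q.1 i
    · rw [hv q i (Or.inr h2), mul_zero, mul_zero, add_zero]
    · rw [if_neg h1, if_neg h2, zero_mul, add_zero]

/-! ### Commutators of the two halves with a site-diagonal multiplication operator -/

/-- `[diag d, F ⊗ P⁻] = diag(d(x)/d(x+î) − 1)·(F ⊗ P⁻)·diag d` for a nonvanishing site function
`d`: the forward half only couples `x` to `x + î`. [folklore] -/
theorem siteDiagonal_comm_hopFwd {d : TorusSite 4 L → ℂ} (hd : ∀ x, d x ≠ 0)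
    (U : GaugeConfig 4 L G) (i : Fin 4) :
    diagonal (fun p : TorusSite 4 L × Fin Nc × Fin 4 => d p.1) *
        Matrix.reindex (Equiv.prodAssoc _ _ _) (Equiv.prodAssoc _ _ _)
          (linkHop ρ U i ⊗ₖ chiralProjMinus i) -
      Matrix.reindex (Equiv.prodAssoc _ _ _) (Equiv.prodAssoc _ _ _)
          (linkHop ρ U i ⊗ₖ chiralProjMinus i) *
        diagonal (fun p : TorusSite 4 L × Fin Nc × Fin 4 => d p.1) =
      diagonal (fun p : TorusSite 4 L × Fin Nc × Fin 4 => d p.1 * (d (Site.shift p.1 i))⁻¹ - 1) *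
        Matrix.reindex (Equiv.prodAssoc _ _ _) (Equiv.prodAssoc _ _ _)
          (linkHop ρ U i ⊗ₖ chiralProjMinus i) *
        diagonal (fun p : TorusSite 4 L × Fin Nc × Fin 4 => d p.1) := by
  ext p q
  simp only [Matrix.sub_apply, diagonal_mul, mul_diagonal, hopFwd_apply]
  split_ifs with h
  · rw [h]
    generalize ρ (U (p.1, i)) p.2.1 q.2.1 * chiralProjMinus i p.2.2 q.2.2 = A
    linear_combination (-(d p.1 * A)) * inv_mul_cancel₀ (hd (Site.shift p.1 i))
  · simp

/-- `[diag d, Fᴴ ⊗ P⁺] = (Fᴴ ⊗ P⁺)·diag(d(y+î)/d(y) − 1)·diag d` for a nonvanishing site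
function `d`: the backward half only couples `y + î` to `y`. [folklore] -/
theorem siteDiagonal_comm_hopBwd {d : TorusSite 4 L → ℂ} (hd : ∀ x, d x ≠ 0)
    (U : GaugeConfig 4 L G) (i : Fin 4) :
    diagonal (fun p : TorusSite 4 L × Fin Nc × Fin 4 => d p.1) *
        Matrix.reindex (Equiv.prodAssoc _ _ _) (Equiv.prodAssoc _ _ _)
          ((linkHop ρ U i)ᴴ ⊗ₖ chiralProjPlus i) -
      Matrix.reindex (Equiv.prodAssoc _ _ _) (Equiv.prodAssoc _ _ _)
          ((linkHop ρ U i)ᴴ ⊗ₖ chiralProjPlus i) *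
        diagonal (fun p : TorusSite 4 L × Fin Nc × Fin 4 => d p.1) =
      Matrix.reindex (Equiv.prodAssoc _ _ _) (Equiv.prodAssoc _ _ _)
          ((linkHop ρ U i)ᴴ ⊗ₖ chiralProjPlus i) *
        diagonal (fun q : TorusSite 4 L × Fin Nc × Fin 4 => d (Site.shift q.1 i) * (d q.1)⁻¹ - 1) *
        diagonal (fun p : TorusSite 4 L × Fin Nc × Fin 4 => d p.1) := by
  ext p q
  simp only [Matrix.sub_apply, diagonal_mul, mul_diagonal, hopBwd_apply]
  split_ifs with h
  · rw [h]
    generalize star (ρ (U (q.1, i)) q.2.1 p.2.1) * chiralProjPlus i p.2.2 q.2.2 = B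
    linear_combination (-(d (Site.shift q.1 i) * B)) * inv_mul_cancel₀ (hd q.1)
  · simp

/-! ### Registered auxiliary sub-goal -/

/-- **Registered auxiliary sub-goal `stub_feshbachLocalisationAux`** (lands this toolkit file in
support of `stub_feshbachLocalisation`): in the fundamental representation of `SU(3)` the Wilson
hopping term `K = Σ_μ W_μ` is bounded by four in `ℓ²`, `‖K v‖₂ ≤ 4‖v‖₂`, on every periodic
lattice and for every gauge field. [folklore] -/
theorem stub_feshbachLocalisationAux :
    ∀ (N : ℕ) [NeZero N] (U : GaugeConfig 4 N (Matrix.specialUnitaryGroup (Fin 3) ℂ))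
      (v : TorusSite 4 N × Fin 3 × Fin 4 → ℂ),
      eucNorm ((∑ i, wilsonHop (fundamentalRep (Fin 3)) U i) *ᵥ v) ≤ 4 * eucNorm v :=
  fun _ _ U v => eucNorm_sum_wilsonHop_mulVec_le _ fundamentalRep_mem_unitaryGroup U v

end Lattice

end Summit.QuantumFields.QCD.Cruxes.SeaFactorisationBridge.ProperTimeQuarantine

end
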